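import Mathlib
import HarnessLib
import Summits.HubbardSuperconductivity.HubbardSuperconductivity.Theorems.KLProgrammeFermiSurfaceSharpRange

/-!
# Route `KLProgramme` (K1 `H10TwoPointLimit`, K3 `KLRegimeTwoPointLimit`) — the SHARP `BandBounds` bundle:
# Lean-certified NUMBERS on the certified window `μ ∈ [-0.4267, -0.1798]` (`δ ∈ [0.10, 0.20]`)

Cell `gate-hubbard-kl`, seat fs-1 (g4), risk r2 (serving r1 «explicit constants»). Numeric corollaries of
`klfs_exists_sharpBandBounds` (`KLProgrammeFermiSurfaceSharpRange.lean`) at `a = -0.4267`, `b = -0.1798`: the two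
transcendental inputs are `d_a = arccos(0.106675) ≥ 1.46` (from `cos 1.46 = sin(π/2 - 1.46) > 0.1105`) and
`K_b = arccos(-0.9101) ≤ 2.72` (from `cos(π - 2.72) ≥ 1 - (π - 2.72)²/2 > 0.911`); everything else is rational
arithmetic with `√2`, `√(-μ(4+μ))`, `√(32 - 2b²)`. Result (`klfs_window_sharpBandBounds`): a `BandBounds (-0.4267) (-0.1798)`
with
  `umin ≥ 2.06`, `smax ≤ 3.85`, `A2 ≤ 33`, `hmin ≥ 0.19`, `amin ≥ 0.0656`, `rhomin ≥ 0.4143`, `cmax ≤ 0.685`,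
  `Dtmin ≥ 0.628`, **`C_g ≤ 96`**, `Dcell ≤ 3.52`
(certified values, kit j252652 / FS-WINDOW.md §6: `2.0703`, `3.8386`, `32.821`, `0.19448`, `0.06587`, `0.41439`,
`0.6792`, `0.63213`, `94.323`, `3.5013`; the tree's generic bundle on the same range: `C_g = 52 285`, `A2 = 908`,
`smax = 18.1`, `Dcell = 10.8`). No definitions; everything PROVED. [folklore]
-/

noncomputable section

open Real Set

-- the tree's namespace `Summit.<Summit>.<Problem>.Theorems` repeats the summit name by design (D-0017)
set_option linter.dupNamespace false

namespace Summit.HubbardSuperconductivity.HubbardSuperconductivity.Theorems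

open Literature.MathematicalPhysics.QuantumLattice
open Literature.MathematicalPhysics.QuantumLattice.BandSectorCounting

/-! ### §1 The numeric inputs -/

/-- `1.41421 ≤ √2 ≤ 1.41422`. [folklore] -/
theorem klfs_num_sqrt_two : (1.41421 : ℝ) ≤ Real.sqrt 2 ∧ Real.sqrt 2 ≤ 1.41422 := by
  constructor
  · rw [Real.le_sqrt (by norm_num) (by norm_num)]; norm_num
  · rw [Real.sqrt_le_left (by norm_num)]; norm_num

/-- **`d_a = arccos(0.106675) ≥ 1.46`** (`cos 1.46 = sin(π/2 - 1.46) > 0.1105 > 0.106675`). [folklore] -/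
theorem klfs_num_arccos_da_ge : (1.46 : ℝ) ≤ Real.arccos (-(-0.4267 : ℝ) / 4) := by
  have hπ1 := Real.pi_gt_d6
  have hπ2 := Real.pi_lt_d6
  set x : ℝ := π / 2 - 1.46 with hx
  have hx1 : (0.110796 : ℝ) ≤ x := by rw [hx]; linarith
  have hx2 : x ≤ (0.110797 : ℝ) := by rw [hx]; linarith
  have hx0 : 0 < x := by linarith
  have hsin : x - x ^ 3 / 6 < Real.sin x := Real.sin_gt_sub_cube hx0
  have hx3 : x ^ 3 ≤ (0.110797 : ℝ) ^ 3 := pow_le_pow_left₀ hx0.le hx2 3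
  have hcos : Real.cos 1.46 = Real.sin x := by rw [hx, Real.sin_pi_div_two_sub]
  have hval : (-(-0.4267 : ℝ) / 4) ≤ Real.cos 1.46 := by rw [hcos]; norm_num at hx3 ⊢; linarith
  have h := Real.antitone_arccos hval
  rwa [Real.arccos_cos (by norm_num) (by linarith)] at h

/-- `d_a ≤ π/2 < 1.5708`. [folklore] -/
theorem klfs_num_arccos_da_le : Real.arccos (-(-0.4267 : ℝ) / 4) ≤ 1.5708 := by
  have h := Real.arccos_lt_pi_div_two.2 (show (0 : ℝ) < -(-0.4267 : ℝ) / 4 by norm_num)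
  have hπ2 := Real.pi_lt_d6
  linarith

/-- **`K_b = arccos(-0.9101) ≤ 2.72`** (`cos(π - 2.72) ≥ 1 - (π - 2.72)²/2 > 0.911`). [folklore] -/
theorem klfs_num_umklappRadius_b_le : umklappRadius (-0.1798) ≤ 2.72 := by
  have hπ1 := Real.pi_gt_d6
  have hπ2 := Real.pi_lt_d6
  set x : ℝ := π - 2.72 with hx
  have hx1 : (0.421592 : ℝ) ≤ x := by rw [hx]; linarith
  have hx2 : x ≤ (0.421593 : ℝ) := by rw [hx]; linarith
  have hc : 1 - x ^ 2 / 2 ≤ Real.cos x := Real.one_sub_sq_div_two_le_cos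
  have hx22 : x ^ 2 ≤ (0.421593 : ℝ) ^ 2 := pow_le_pow_left₀ (by linarith) hx2 2
  have hcos : Real.cos 2.72 = -Real.cos x := by
    rw [hx, Real.cos_pi_sub, neg_neg]
  have hval : Real.cos 2.72 ≤ -(-0.1798 : ℝ) / 2 - 1 := by rw [hcos]; norm_num at hx22 ⊢; linarith
  have h := Real.antitone_arccos hval
  rw [Real.arccos_cos (by norm_num) (by linarith)] at h
  exact h

/-- `0.4143 ≤ s_* = min(s_a, s_b)` and `s_* ≤ s_b ≤ 0.4144` on the certified window. [folklore] -/
theorem klfs_num_levelSin_min :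
    (0.4143 : ℝ) ≤ min (Real.sqrt (-(-0.4267 : ℝ) * (4 + -0.4267)) / 2) (Real.sqrt (-(-0.1798 : ℝ) * (4 + -0.1798)) / 2) ∧
    min (Real.sqrt (-(-0.4267 : ℝ) * (4 + -0.4267)) / 2) (Real.sqrt (-(-0.1798 : ℝ) * (4 + -0.1798)) / 2) ≤ 0.4144 := by
  have ha : (0.617 : ℝ) ≤ Real.sqrt (-(-0.4267 : ℝ) * (4 + -0.4267)) / 2 := by
    rw [le_div_iff₀ (by norm_num : (0:ℝ) < 2), Real.le_sqrt (by norm_num) (by norm_num)]; norm_num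
  have hb : (0.4143 : ℝ) ≤ Real.sqrt (-(-0.1798 : ℝ) * (4 + -0.1798)) / 2 := by
    rw [le_div_iff₀ (by norm_num : (0:ℝ) < 2), Real.le_sqrt (by norm_num) (by norm_num)]; norm_num
  have hb' : Real.sqrt (-(-0.1798 : ℝ) * (4 + -0.1798)) / 2 ≤ 0.4144 := by
    rw [div_le_iff₀ (by norm_num : (0:ℝ) < 2), Real.sqrt_le_left (by norm_num)]; norm_num
  exact ⟨le_min (by linarith) hb, (min_le_right _ _).trans hb'⟩

/-- `0.03181 ≤ κ_b = 0.1798/√(32 - 2·0.1798²)`. [folklore] -/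
theorem klfs_num_kappa_b_ge : (0.03181 : ℝ) ≤ -(-0.1798 : ℝ) / Real.sqrt (32 - 2 * (-0.1798 : ℝ) ^ 2) := by
  have hs : Real.sqrt (32 - 2 * (-0.1798 : ℝ) ^ 2) ≤ 5.6512 := by
    rw [Real.sqrt_le_left (by norm_num)]; norm_num
  have hs0 : 0 < Real.sqrt (32 - 2 * (-0.1798 : ℝ) ^ 2) := Real.sqrt_pos.2 (by norm_num)
  rw [le_div_iff₀ hs0]
  nlinarith

/-- `0.0897 ≤ min(n_a, n_b)` (`n_μ = (-μ/2)(1 - μ²/16)`; the minimum is `n_b = 0.08972`). [folklore] -/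
theorem klfs_num_levelN_min_ge :
    (0.0897 : ℝ) ≤ min (-(-0.4267 : ℝ) / 2 * (1 - (-0.4267 : ℝ) ^ 2 / 16)) (-(-0.1798 : ℝ) / 2 * (1 - (-0.1798 : ℝ) ^ 2 / 16)) :=
  le_min (by norm_num) (by norm_num)

/-- `sin d_a / d_a ≤ 1/1.46 < 0.685`. [folklore] -/
theorem klfs_num_sinc_da_le : Real.sin (Real.arccos (-(-0.4267 : ℝ) / 4)) / Real.arccos (-(-0.4267 : ℝ) / 4) ≤ 0.685 := by
  have hd := klfs_num_arccos_da_ge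
  have hd0 : 0 < Real.arccos (-(-0.4267 : ℝ) / 4) := by linarith
  rw [div_le_iff₀ hd0]
  have := Real.sin_le_one (Real.arccos (-(-0.4267 : ℝ) / 4))
  nlinarith

/-- `0 < sin d_a / d_a`. [folklore] -/
theorem klfs_num_sinc_da_pos : 0 < Real.sin (Real.arccos (-(-0.4267 : ℝ) / 4)) / Real.arccos (-(-0.4267 : ℝ) / 4) := by
  have hd := klfs_num_arccos_da_ge
  have hdle := klfs_num_arccos_da_le
  have hd0 : 0 < Real.arccos (-(-0.4267 : ℝ) / 4) := by linarith
  exact div_pos (Real.sin_pos_of_pos_of_lt_pi hd0 (by linarith [Real.pi_gt_d6])) hd0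

/-- `0.1523 ≤ sin K_b / K_b = cQ(-0.1798)` (`sin K_b = s_b ≥ 0.4143`, `K_b ≤ 2.72`). [folklore] -/
theorem klfs_num_cQ_b_ge : (0.1523 : ℝ) ≤ cQ (-0.1798) := by
  have hK := klfs_num_umklappRadius_b_le
  have hK0 : 0 < umklappRadius (-0.1798) := umklappRadius_pos (by norm_num)
  have hsin : Real.sin (umklappRadius (-0.1798)) = Real.sqrt (-(-0.1798 : ℝ) * (4 + -0.1798)) / 2 :=
    klfs_sin_umklappRadius (by norm_num) (by norm_num)
  have hs : (0.4143 : ℝ) ≤ Real.sqrt (-(-0.1798 : ℝ) * (4 + -0.1798)) / 2 := by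
    rw [le_div_iff₀ (by norm_num : (0:ℝ) < 2), Real.le_sqrt (by norm_num) (by norm_num)]; norm_num
  rw [cQ, hsin, le_div_iff₀ hK0]
  nlinarith

/-! ### §2 The numbers of the sharp bundle on the certified window -/

/-- **The SHARP bundle on the certified window `μ ∈ [-0.4267, -0.1798]` with its constants as numbers**:
`umin ≥ 2.06`, `smax ≤ 3.85`, `A2 ≤ 33`, `hmin ≥ 0.19`, `amin ≥ 0.0656`, `rhomin ≥ 0.4143`, `cmax ≤ 0.685`,
`Dtmin ≥ 0.628`, `C_g ≤ 96`, `Dcell ≤ 3.52` (generic `bandBounds` on the same range: `umin = 1.89`, `smax = 18.1`,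
`A2 = 908`, `hmin = 0.0794`, `amin = 3.8·10⁻⁴`, `rhomin = 0.289`, `cmax = 1.06`, `Dtmin = 0.577`, `C_g = 52 285`,
`Dcell = 10.8`). [folklore] -/
theorem klfs_window_sharpBandBounds :
    ∃ B : BandBounds (-0.4267) (-0.1798),
      2.06 ≤ B.umin ∧ B.smax ≤ 3.85 ∧ B.A2 ≤ 33 ∧ 0.19 ≤ B.hmin ∧ 0.0656 ≤ B.amin ∧ 0.4143 ≤ B.rhomin ∧
      B.cmax ≤ 0.685 ∧ 0.628 ≤ B.Dtmin ∧ B.Cg ≤ 96 ∧ B.Dcell ≤ 3.52 := by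
  obtain ⟨B, hu, hs, hA, hh, ham, hr, hc, hD⟩ :=
    klfs_exists_sharpBandBounds (a := -0.4267) (b := -0.1798) (by norm_num) (by norm_num) (by norm_num)
  obtain ⟨h2l, h2u⟩ := klfs_num_sqrt_two
  have hd := klfs_num_arccos_da_ge
  have hK := klfs_num_umklappRadius_b_le
  have hK0 : 0 < umklappRadius (-0.1798) := umklappRadius_pos (by norm_num)
  obtain ⟨hsl, hsu⟩ := klfs_num_levelSin_min
  have hκ := klfs_num_kappa_b_ge
  have hn := klfs_num_levelN_min_ge
  have hsinc := klfs_num_sinc_da_le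
  have hsinc0 := klfs_num_sinc_da_pos
  have hq := klfs_num_cQ_b_ge
  -- the eight fields
  have e_umin : 2.06 ≤ B.umin := by
    rw [hu]
    calc (2.06 : ℝ) ≤ 1.41421 * 1.46 := by norm_num
      _ ≤ Real.sqrt 2 * Real.arccos (-(-0.4267 : ℝ) / 4) := mul_le_mul h2l hd (by norm_num) (Real.sqrt_nonneg 2)
  have e_smax : B.smax ≤ 3.85 := by
    rw [hs]
    calc Real.sqrt 2 * umklappRadius (-0.1798) ≤ 1.41422 * 2.72 := mul_le_mul h2u hK hK0.le (by norm_num)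
      _ ≤ 3.85 := by norm_num
  have e_A2 : B.A2 ≤ 33 := by
    rw [hA]
    have h1 : umklappRadius (-0.1798) ^ 2 /
        min (Real.sqrt (-(-0.4267 : ℝ) * (4 + -0.4267)) / 2) (Real.sqrt (-(-0.1798 : ℝ) * (4 + -0.1798)) / 2) ≤
        2.72 ^ 2 / 0.4143 :=
      (div_le_div_of_nonneg_right (pow_le_pow_left₀ hK0.le hK 2) (by linarith)).trans
        (div_le_div_of_nonneg_left (by norm_num) (by norm_num) hsl)
    have h3 : 0 ≤ umklappRadius (-0.1798) ^ 2 /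
        min (Real.sqrt (-(-0.4267 : ℝ) * (4 + -0.4267)) / 2) (Real.sqrt (-(-0.1798 : ℝ) * (4 + -0.1798)) / 2) +
        2 * umklappRadius (-0.1798) := by positivity
    calc Real.sqrt 2 * (umklappRadius (-0.1798) ^ 2 /
          min (Real.sqrt (-(-0.4267 : ℝ) * (4 + -0.4267)) / 2) (Real.sqrt (-(-0.1798 : ℝ) * (4 + -0.1798)) / 2) +
          2 * umklappRadius (-0.1798))
        ≤ 1.41422 * (2.72 ^ 2 / 0.4143 + 2 * 2.72) := mul_le_mul h2u (by linarith) h3 (by norm_num)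
      _ ≤ 33 := by norm_num
  have e_hmin : 0.19 ≤ B.hmin := by
    rw [hh, le_div_iff₀ (pow_pos hsinc0 2)]
    have h1 : (Real.sin (Real.arccos (-(-0.4267 : ℝ) / 4)) / Real.arccos (-(-0.4267 : ℝ) / 4)) ^ 2 ≤ 0.685 ^ 2 :=
      pow_le_pow_left₀ hsinc0.le hsinc 2
    calc (0.19 : ℝ) * (Real.sin (Real.arccos (-(-0.4267 : ℝ) / 4)) / Real.arccos (-(-0.4267 : ℝ) / 4)) ^ 2
        ≤ 0.19 * 0.685 ^ 2 := mul_le_mul_of_nonneg_left h1 (by norm_num)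
      _ ≤ 0.0897 := by norm_num
      _ ≤ _ := hn
  have e_amin : 0.0656 ≤ B.amin := by
    rw [ham]
    calc (0.0656 : ℝ) ≤ 0.03181 * (1.41421 * 1.46) := by norm_num
      _ ≤ _ := mul_le_mul hκ (mul_le_mul h2l hd (by norm_num) (Real.sqrt_nonneg 2)) (by norm_num) (by linarith)
  have e_rhomin : 0.4143 ≤ B.rhomin := by rw [hr]; exact hsl
  have e_cmax : B.cmax ≤ 0.685 := by rw [hc]; exact hsinc
  have e_Dtmin : 0.628 ≤ B.Dtmin := by
    rw [hD]
    refine le_max_of_le_right ?_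
    calc (0.628 : ℝ) ≤ 2 * 0.1523 * (1.41421 * 1.46) := by norm_num
      _ ≤ 2 * cQ (-0.1798) * (Real.sqrt 2 * Real.arccos (-(-0.4267 : ℝ) / 4)) :=
          mul_le_mul (by linarith) (mul_le_mul h2l hd (by norm_num) (Real.sqrt_nonneg 2)) (by norm_num) (by linarith)
  -- derived constants
  have e_Cg : B.Cg ≤ 96 := by
    have hπ := Real.pi_lt_d4
    have hBa : 0 < B.amin := B.amin_pos
    have hBr : 0 < B.rhomin := B.rhomin_pos
    rw [BandBounds.Cg, div_le_iff₀ (by positivity)]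
    have h1 : π * B.cmax ≤ 3.1416 * 0.685 := mul_le_mul hπ.le e_cmax B.cmax_pos.le (by norm_num)
    have h2 : (0.0656 : ℝ) * 0.4143 ^ 2 ≤ B.amin * B.rhomin ^ 2 :=
      mul_le_mul e_amin (pow_le_pow_left₀ (by norm_num) e_rhomin 2) (by norm_num) hBa.le
    have h3 : 96 * (2 * B.amin * B.rhomin ^ 2) = 192 * (B.amin * B.rhomin ^ 2) := by ring
    rw [h3]
    linarith
  have e_Dcell : B.Dcell ≤ 3.52 := by
    rw [BandBounds.Dcell]
    have h1 : 1 / B.Dtmin ≤ 1 / 0.628 := div_le_div_of_nonneg_left (by norm_num) (by norm_num) e_Dtmin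
    have h2 : (1 : ℝ) / 0.628 ≤ 1.5924 := by norm_num
    linarith
  exact ⟨B, e_umin, e_smax, e_A2, e_hmin, e_amin, e_rhomin, e_cmax, e_Dtmin, e_Cg, e_Dcell⟩

end Summit.HubbardSuperconductivity.HubbardSuperconductivity.Theorems

end
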